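import Literature.AnabelianGeometry.EtaleTheta.ContH1Complements
import Literature.AnabelianGeometry.EtaleTheta.ContH1Injectivity
import HarnessLib

/-!
# [EtTh] §1, Prop. 1.5 (i)(ii): the identifications «F¹/F² = Ẑ·log(U)», «F̈¹/F̈² = Ẑ·log(Ü)» — typed at
# the root, `Ẑ`-free (additive predicates)

Mochizuki, *The étale theta function and its Frobenioid-theoretic manifestations*, Publ. RIMS **45**
(2009), §1, Prop. 1.5 (i)(ii), PRIMS PDF p. 23 (printed 249) [cite: MochizukiEtTh2009, Prop 1.5 (ii) p.23].
abc-iut cell, layer L2, seat abc-iut-L2-t1 (§1 ROOT owner); residual G-K3-2 of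
`plan/L2/K3-RESIDUAL-GAPS.md` and GAP row G-L2t1-1. CLASS (c): ADDITIVE named predicates over the FROZEN
root (`ThetaCohomology.lean`: `F1`, `F2`, `Fdd1`, `Fdd2`, `Prop15i`, `Prop15ii` record only «log(U) ∈ F¹»,
«F² = Kummer classes» and «restriction to Δ_Θ surjective»; the «= Ẑ·log» identifications are listed there
as NOT TYPED). Nothing asserted; no field of a frozen structure touched.

PRINT (p. 23): «(i) … a natural filtration 0 ⊆ F² ⊆ F¹ ⊆ F⁰ = H¹((Π^tp_Y)^Θ, Δ_Θ) … with subquotients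
F⁰/F¹ = Hom(Δ_Θ, Δ_Θ) = Ẑ·log(Θ); F¹/F² = Hom((Δ^tp_Y)^ell/Δ_Θ, Δ_Θ) = Ẑ·log(U); F² = H¹(G_K, Δ_Θ) ⥲ …
⥲ (K^×)^∧ — where we use the symbol log(Θ) to denote the identity morphism Δ_Θ → Δ_Θ and the symbol log(U)
to denote the standard isomorphism (Δ^tp_Y)^ell/Δ_Θ ⥲ Ẑ(1) ⥲ Δ_Θ. (ii) Similarly … F̈¹/F̈² =
Hom((Δ^tp_Ÿ)^ell/Δ_Θ, Δ_Θ) = Ẑ·log(Ü) … — where we write log(Ü) := ½·log(U).» (READING NOTE of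
`ThetaCohomology.lean`: «(Δ^tp_Y)^ell/Δ_Θ» [sic] is `(Δ^tp_Y)^Θ/Δ_Θ = (Δ^tp_Y)^ell`.)

## How it is typed (read with the referee)

The tree's `H¹` (`ContH1`) carries no `Ẑ`-module structure, so «= Ẑ·log(Ü)» is typed through the ring
that print's `Ẑ` IS here: the continuous endomorphisms of `Δ_Θ` («Δ_Θ (≅ Ẑ(1))», p. 12). Since `Δ_Θ` is
central in `(Δ^tp_X)^Θ` (root field `ker_thetaToEll_central`), classes of `H¹((Δ^tp_Ÿ)^Θ, Δ_Θ)` ARE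
continuous homomorphisms (`ThetaSetting.homClass`, coboundaries vanish: `homClass_eq_one_iff`), and:
* `ThetaSetting.IsStdLog λ` — `λ : (Δ^tp_Ÿ)^Θ → Δ_Θ` (resp. `(Δ^tp_Y)^Θ → Δ_Θ`) is a continuous surjective
  homomorphism with kernel `Δ_Θ` («the standard isomorphism (Δ^tp_Ÿ)^Θ/Δ_Θ ⥲ Δ_Θ»);
* `ThetaSetting.Fdd1QuotSpec E hC λ` — (a) the restriction of `log(Ü)` to `(Δ^tp_Ÿ)^Θ` is the class of
  `λ`; (b) every `d ∈ F̈¹` restricts to the class of `e ∘ λ` for some continuous endomorphism `e` of `Δ_Θ`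
  («F̈¹/F̈² ⊆ Ẑ·log(Ü)», `F̈² = Ker(res)` by definition); (c) every `e` so occurs («⊇»);
* `ThetaSetting.Prop15iiQuot E hC := ∃ λ, IsStdLog λ ∧ Fdd1QuotSpec E hC λ`, and the twin `Prop15iQuot`
  for `Y`, `F¹`, `log(U)`.
CONSEQUENCES (PROVED): the two finite fragments the cell's consumers bind — `htf` of the K3 capstone
(`∀ d ∈ F̈¹, d·d ∈ F̈² → d ∈ F̈²`, abc-iut-L6-d5 p431263) from `Prop15iiQuot` + «Δ_Θ has no 2-torsion», and
`hL` of GAP G-L2t1-1 (`∀ n, log(Ü)^n ∈ F̈² → n = 0`, abc-iut-L2-t7/L2-t8) from `Prop15iiQuot` + «Δ_Θ is not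
killed by a nonzero integer» — both torsion facts being the content of «Δ_Θ ≅ Ẑ(1)» (cyclotome files).
HONEST FRAMING: [EtTh] is refereed; nothing here is asserted or bears on [IUTchIII] Cor. 3.12; typed ≠ proved.
-/

noncomputable section

namespace Literature.AnabelianGeometry.EtaleTheta

open Literature.AnabelianGeometry.SemiGraphs
open scoped IsMulCommutative

namespace ThetaSetting

variable {p : ℕ} [Fact p.Prime] {D : ThetaSetting p}

/-! ### Classes of homomorphisms on subgroups of `(Δ^tp_X)^Θ` (trivial action on the central `Δ_Θ`) -/

/-- `Δ_Θ` is central in `(Δ^tp_X)^Θ`: conjugation by an element of `(Δ^tp_X)^Θ` fixes `Δ_Θ` pointwise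
(root field `ker_thetaToEll_central`, p. 12 «Δ^Θ_X … ∧² Δ^ell_X»). [cite: MochizukiEtTh2009, §1 p.12] -/
theorem conjNormal_deltaTheta_eq_self {g : D.GtpTheta} (hg : g ∈ D.DeltaTemp.map D.toTheta)
    (t : D.DeltaTheta) : MulAut.conjNormal g t = t := by
  apply Subtype.ext
  rw [MulAut.conjNormal_apply]
  have h := D.ker_thetaToEll_central t.1 t.2 g hg
  rw [← h, mul_inv_cancel_right]

/-- `(Δ^tp_Ÿ)^Θ ≤ (Δ^tp_X)^Θ` and `(Δ^tp_Y)^Θ ≤ (Δ^tp_X)^Θ`. [cite: MochizukiEtTh2009, §1 p.12] -/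
theorem dtpYddTheta_le_deltaTheta_map : (D.DtpYddN 1).map D.toTheta ≤ D.DeltaTemp.map D.toTheta :=
  Subgroup.map_mono inf_le_right

/-- `(Δ^tp_Y)^Θ ≤ (Δ^tp_X)^Θ`. [cite: MochizukiEtTh2009, §1 p.12] -/
theorem dtpYTheta_le_deltaTheta_map : D.DtpYTheta ≤ D.DeltaTemp.map D.toTheta :=
  Subgroup.map_mono inf_le_right

/-- A continuous homomorphism `f : H' → Δ_Θ` on a subgroup `H' ≤ (Δ^tp_X)^Θ` IS a continuous cocycle (the
action of `H'` on the central `Δ_Θ` is trivial): «Hom((Δ^tp_Y)^ell …, Δ_Θ)» as classes of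
`H¹((Δ^tp_Y)^Θ, Δ_Θ)` (p. 23). [cite: MochizukiEtTh2009, Prop 1.5 (i) p.23] -/
theorem hom_mem_contCocycles {H' : Subgroup D.GtpTheta} (hH : H' ≤ D.DeltaTemp.map D.toTheta)
    (f : H' →ₜ* D.DeltaTheta) :
    (fun h => f h) ∈ contCocycles (MonoidHom.id D.GtpTheta) D.DeltaTheta H' := by
  refine ⟨map_continuous f, fun g h => ?_⟩
  change f (g * h) = f g * MulAut.conjNormal ((MonoidHom.id D.GtpTheta) (g : D.GtpTheta)) (f h)
  rw [map_mul, MonoidHom.id_apply, conjNormal_deltaTheta_eq_self (hH g.2)]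

/-- **The class of a homomorphism**: `Hom_cont(H', Δ_Θ) → H¹(H', Δ_Θ)` for `H' ≤ (Δ^tp_X)^Θ` (p. 23,
`F¹/F² = Hom(…, Δ_Θ)`). [cite: MochizukiEtTh2009, Prop 1.5 (i) p.23] -/
def homClass {H' : Subgroup D.GtpTheta} (hH : H' ≤ D.DeltaTemp.map D.toTheta)
    (f : H' →ₜ* D.DeltaTheta) : D.H1Theta H' :=
  ContH1.mk (fun h => f h) (hom_mem_contCocycles hH f)

/-- `homClass` is multiplicative (pointwise product of homomorphisms into the abelian `Δ_Θ`).
[cite: MochizukiEtTh2009, Prop 1.5 (i) p.23] -/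
theorem homClass_mul {H' : Subgroup D.GtpTheta} (hH : H' ≤ D.DeltaTemp.map D.toTheta)
    (f g : H' →ₜ* D.DeltaTheta) : homClass hH f * homClass hH g = homClass hH (f * g) :=
  ContH1.mk_mul_mk _ _ _ _ _

/-- `homClass` respects powers. [cite: MochizukiEtTh2009, Prop 1.5 (i) p.23] -/
theorem homClass_pow {H' : Subgroup D.GtpTheta} (hH : H' ≤ D.DeltaTemp.map D.toTheta)
    (f : H' →ₜ* D.DeltaTheta) (n : ℕ) : homClass hH f ^ n = homClass hH (f ^ n) := by
  induction n with
  | zero => simp only [pow_zero]; rfl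
  | succ n ih => rw [pow_succ, ih, homClass_mul, ← pow_succ]

/-- On a subgroup of `(Δ^tp_X)^Θ` the coboundaries vanish, so the class of a homomorphism is trivial iff the
homomorphism is: `Hom_cont(H', Δ_Θ) ↪ H¹(H', Δ_Θ)`. [cite: MochizukiEtTh2009, Prop 1.5 (i) p.23] -/
theorem homClass_eq_one_iff {H' : Subgroup D.GtpTheta} (hH : H' ≤ D.DeltaTemp.map D.toTheta)
    (f : H' →ₜ* D.DeltaTheta) : homClass hH f = 1 ↔ ∀ h, f h = 1 := by
  unfold homClass
  rw [ContH1.mk_eq_one_iff, mem_contCoboundaries_iff]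
  constructor
  · rintro ⟨a, ha⟩ h
    have := congrFun ha h
    rw [MonoidHom.id_apply, conjNormal_deltaTheta_eq_self (hH h.2), mul_inv_cancel] at this
    exact this
  · intro hf
    refine ⟨1, funext fun h => ?_⟩
    rw [hf h, map_one, inv_one, mul_one]

/-- `homClass` is injective. [cite: MochizukiEtTh2009, Prop 1.5 (i) p.23] -/
theorem homClass_injective {H' : Subgroup D.GtpTheta} (hH : H' ≤ D.DeltaTemp.map D.toTheta) :
    Function.Injective (homClass (D := D) hH) := by
  intro f g hfg
  unfold homClass at hfg
  rw [ContH1.mk_eq_mk_iff] at hfg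
  obtain ⟨a, ha⟩ := hfg
  ext h
  have := ha h
  rw [MonoidHom.id_apply, conjNormal_deltaTheta_eq_self (hH h.2), mul_inv_cancel, inv_mul_eq_one] at this
  rw [this]

/-! ### «the standard isomorphism (Δ^tp_?)^Θ/Δ_Θ ⥲ Δ_Θ» and «F^?¹/F^?² = Ẑ·log(?)» -/

/-- **`λ` is (the homomorphism underlying) «the standard isomorphism `H'/Δ_Θ ⥲ Δ_Θ`»** (p. 23, for
`H' = (Δ^tp_Y)^Θ` resp. `(Δ^tp_Ÿ)^Θ`): a continuous homomorphism `H' → Δ_Θ` onto `Δ_Θ` with kernel exactly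
`Δ_Θ`. [cite: MochizukiEtTh2009, Prop 1.5 (i) p.23] -/
structure IsStdLog {H' : Subgroup D.GtpTheta} (lam : H' →ₜ* D.DeltaTheta) : Prop where
  /-- onto `Δ_Θ` -/
  surjective : Function.Surjective lam
  /-- kernel `= Δ_Θ` -/
  ker_iff : ∀ h : H', lam h = 1 ↔ (h : D.GtpTheta) ∈ D.DeltaTheta

/-- **«F̈¹/F̈² = Hom((Δ^tp_Ÿ)^ell, Δ_Θ) = Ẑ · log(Ü)»** relative to `λ` (Prop. 1.5 (ii), p. 23): (a) `log(Ü)`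
restricts on `(Δ^tp_Ÿ)^Θ` to the class of `λ`; (b) every class of `F̈¹ = Ker(res to Δ_Θ)` restricts on
`(Δ^tp_Ÿ)^Θ` to the class of `e ∘ λ` for a continuous endomorphism `e` of `Δ_Θ` — print's coefficient
`∈ Ẑ = End(Ẑ(1))`; (c) every `e` occurs. (`F̈² = Ker(res to (Δ^tp_Ÿ)^Θ)` by definition, so (b)+(c) say
precisely `F̈¹/F̈² ≅ End_cont(Δ_Θ) · [λ]`.) [cite: MochizukiEtTh2009, Prop 1.5 (ii) p.23] -/
structure Fdd1QuotSpec (E : D.KummerData) (hC : D.Compat)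
    (lam : ↥((D.DtpYddN 1).map D.toTheta) →ₜ* D.DeltaTheta) : Prop where
  /-- (a) `res_{(Δ^tp_Ÿ)^Θ} log(Ü) = [λ]` -/
  res_logUdd : ContH1.res (MonoidHom.id D.GtpTheta) D.DeltaTheta
      (Subgroup.map_mono inf_le_left : (D.DtpYddN 1).map D.toTheta ≤ D.GtpYdd.map D.toTheta) E.logUdd =
    homClass dtpYddTheta_le_deltaTheta_map lam
  /-- (b) `F̈¹/F̈² ⊆ Ẑ · log(Ü)` -/
  exists_endo : ∀ d ∈ Fdd1 hC, ∃ e : D.DeltaTheta →ₜ* D.DeltaTheta,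
    ContH1.res (MonoidHom.id D.GtpTheta) D.DeltaTheta
        (Subgroup.map_mono inf_le_left : (D.DtpYddN 1).map D.toTheta ≤ D.GtpYdd.map D.toTheta) d =
      homClass dtpYddTheta_le_deltaTheta_map (e.comp lam)
  /-- (c) `Ẑ · log(Ü) ⊆ F̈¹/F̈²` -/
  endo_occurs : ∀ e : D.DeltaTheta →ₜ* D.DeltaTheta, ∃ d ∈ Fdd1 hC,
    ContH1.res (MonoidHom.id D.GtpTheta) D.DeltaTheta
        (Subgroup.map_mono inf_le_left : (D.DtpYddN 1).map D.toTheta ≤ D.GtpYdd.map D.toTheta) d =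
      homClass dtpYddTheta_le_deltaTheta_map (e.comp lam)

/-- **[EtTh] Prop. 1.5 (ii), the identification `F̈¹/F̈² = Hom((Δ^tp_Ÿ)^ell/Δ_Θ [sic], Δ_Θ) = Ẑ · log(Ü)`**
(p. 23), `Ẑ`-free: there is a standard-isomorphism-shaped `λ : (Δ^tp_Ÿ)^Θ → Δ_Θ` for which `Fdd1QuotSpec`
holds. Companion of the frozen `Prop15ii` (which types the other clauses of (ii)).
[cite: MochizukiEtTh2009, Prop 1.5 (ii) p.23] -/
def Prop15iiQuot (E : D.KummerData) (hC : D.Compat) : Prop :=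
  ∃ lam : ↥((D.DtpYddN 1).map D.toTheta) →ₜ* D.DeltaTheta, IsStdLog lam ∧ Fdd1QuotSpec E hC lam

/-- **«F¹/F² = Hom((Δ^tp_Y)^ell, Δ_Θ) = Ẑ · log(U)»** relative to `λ` (Prop. 1.5 (i), p. 23): as
`Fdd1QuotSpec` for `Y`, `F¹`, `log(U)`. [cite: MochizukiEtTh2009, Prop 1.5 (i) p.23] -/
structure F1QuotSpec (E : D.KummerData) (hC : D.Compat) (lam : D.DtpYTheta →ₜ* D.DeltaTheta) : Prop where
  /-- (a) `res_{(Δ^tp_Y)^Θ} log(U) = [λ]` -/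
  res_logU : ContH1.res (MonoidHom.id D.GtpTheta) D.DeltaTheta
      (Subgroup.map_mono inf_le_left : D.DtpYTheta ≤ D.GtpY.map D.toTheta) E.logU =
    homClass dtpYTheta_le_deltaTheta_map lam
  /-- (b) `F¹/F² ⊆ Ẑ · log(U)` -/
  exists_endo : ∀ d ∈ F1 hC, ∃ e : D.DeltaTheta →ₜ* D.DeltaTheta,
    ContH1.res (MonoidHom.id D.GtpTheta) D.DeltaTheta
        (Subgroup.map_mono inf_le_left : D.DtpYTheta ≤ D.GtpY.map D.toTheta) d =
      homClass dtpYTheta_le_deltaTheta_map (e.comp lam)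
  /-- (c) `Ẑ · log(U) ⊆ F¹/F²` -/
  endo_occurs : ∀ e : D.DeltaTheta →ₜ* D.DeltaTheta, ∃ d ∈ F1 hC,
    ContH1.res (MonoidHom.id D.GtpTheta) D.DeltaTheta
        (Subgroup.map_mono inf_le_left : D.DtpYTheta ≤ D.GtpY.map D.toTheta) d =
      homClass dtpYTheta_le_deltaTheta_map (e.comp lam)

/-- **[EtTh] Prop. 1.5 (i), the identification `F¹/F² = Hom((Δ^tp_Y)^ell/Δ_Θ [sic], Δ_Θ) = Ẑ · log(U)`**
(p. 23), `Ẑ`-free. Companion of the frozen `Prop15i`. [cite: MochizukiEtTh2009, Prop 1.5 (i) p.23] -/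
def Prop15iQuot (E : D.KummerData) (hC : D.Compat) : Prop :=
  ∃ lam : D.DtpYTheta →ₜ* D.DeltaTheta, IsStdLog lam ∧ F1QuotSpec E hC lam

/-! ### Consequences (PROVED): the finite fragments bound by the cell's consumers -/

/-- Membership in `F̈²` is vanishing of the restriction to `(Δ^tp_Ÿ)^Θ` (definition).
[cite: MochizukiEtTh2009, Prop 1.5 (ii) p.23] -/
theorem mem_Fdd2_iff (d : D.H1Theta (D.GtpYdd.map D.toTheta)) :
    d ∈ (Fdd2 : Subgroup (D.H1Theta (D.GtpYdd.map D.toTheta))) ↔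
      ContH1.res (MonoidHom.id D.GtpTheta) D.DeltaTheta
        (Subgroup.map_mono inf_le_left : (D.DtpYddN 1).map D.toTheta ≤ D.GtpYdd.map D.toTheta) d = 1 :=
  MonoidHom.mem_ker

/-- **`htf` from Prop. 1.5 (ii)** («F̈¹/F̈² = Ẑ·log(Ü)» is torsion-free because `Δ_Θ ≅ Ẑ(1)` is): if `Δ_Θ`
has no `2`-torsion, a class `d ∈ F̈¹` with `d² ∈ F̈²` lies in `F̈²` — the binder `htf` of the K3 capstone
(`Thm16Sub.thm16iii_of_printedClauses*`). [cite: MochizukiEtTh2009, Prop 1.5 (ii) p.23] -/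
theorem Prop15iiQuot.mem_Fdd2_of_sq_mem {E : D.KummerData} {hC : D.Compat} (h : Prop15iiQuot E hC)
    (h2 : ∀ t : D.DeltaTheta, t * t = 1 → t = 1)
    {d : D.H1Theta (D.GtpYdd.map D.toTheta)} (hd : d ∈ Fdd1 hC)
    (hsq : d * d ∈ (Fdd2 : Subgroup (D.H1Theta (D.GtpYdd.map D.toTheta)))) :
    d ∈ (Fdd2 : Subgroup (D.H1Theta (D.GtpYdd.map D.toTheta))) := by
  obtain ⟨lam, -, hspec⟩ := h
  obtain ⟨e, he⟩ := hspec.exists_endo d hd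
  rw [mem_Fdd2_iff] at hsq ⊢
  rw [map_mul, he, homClass_mul, homClass_eq_one_iff] at hsq
  rw [he, homClass_eq_one_iff]
  intro x
  exact h2 _ (by simpa only [ContinuousMonoidHom.mul_apply] using hsq x)

/-- **`hL` from Prop. 1.5 (ii)** («log(Ü) generates the rank-one free quotient F̈¹/F̈²»): if no nonzero
integer kills `Δ_Θ`, then `log(Ü)^n ∈ F̈²` forces `n = 0` — the binder `hL` of GAP G-L2t1-1
(`EtaleThetaData.not_isOfFinOrder_conj_div` et seq.). [cite: MochizukiEtTh2009, Prop 1.5 (ii) p.23] -/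
theorem Prop15iiQuot.eq_zero_of_logUdd_zpow_mem {E : D.KummerData} {hC : D.Compat} (h : Prop15iiQuot E hC)
    (htor : ∀ n : ℤ, n ≠ 0 → ∃ t : D.DeltaTheta, t ^ n ≠ 1) {n : ℤ}
    (hn : E.logUdd ^ n ∈ (Fdd2 : Subgroup (D.H1Theta (D.GtpYdd.map D.toTheta)))) : n = 0 := by
  obtain ⟨lam, hstd, hspec⟩ := h
  by_contra hne
  obtain ⟨t, ht⟩ := htor n hne
  obtain ⟨x, rfl⟩ := hstd.surjective t
  apply ht
  -- `res (log(Ü)^n) = [λ]^n = 1` pointwise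
  have key : ∀ m : ℕ, E.logUdd ^ m ∈ (Fdd2 : Subgroup (D.H1Theta (D.GtpYdd.map D.toTheta))) →
      ∀ y, lam y ^ m = 1 := by
    intro m hm y
    rw [mem_Fdd2_iff, map_pow, hspec.res_logUdd, homClass_pow, homClass_eq_one_iff] at hm
    simpa only [ContinuousMonoidHom.pow_apply] using hm y
  rcases Int.natAbs_eq n with hcase | hcase
  · rw [hcase, zpow_natCast]
    exact key n.natAbs (by rwa [← zpow_natCast, ← hcase]) x
  · rw [hcase, zpow_neg, zpow_natCast, inv_eq_one]
    refine key n.natAbs ?_ x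
    have := inv_mem hn
    rwa [← zpow_neg, hcase, neg_neg, zpow_natCast] at this

/-! ### Junction with the frozen `Prop15i`/`Prop15ii` (PROVED): «log(U) ∈ F¹», «log(Ü) ∈ F̈¹» follow -/

/-- The continuous inclusion of subgroups `H₁ ≤ H₂` of `(Π^tp_X)^Θ`. [cite: MochizukiEtTh2009, Prop 1.5 (i) p.23] -/
def inclCMH {H₁ H₂ : Subgroup D.GtpTheta} (h : H₁ ≤ H₂) : H₁ →ₜ* H₂ where
  toMonoidHom := Subgroup.inclusion h
  continuous_toFun := continuous_induced_rng.2 continuous_subtype_val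

/-- Restricting the class of a homomorphism restricts the homomorphism.
[cite: MochizukiEtTh2009, Prop 1.5 (i) p.23] -/
theorem res_homClass {H₁ H₂ : Subgroup D.GtpTheta} (h12 : H₁ ≤ H₂) (hH : H₂ ≤ D.DeltaTemp.map D.toTheta)
    (f : H₂ →ₜ* D.DeltaTheta) :
    ContH1.res (MonoidHom.id D.GtpTheta) D.DeltaTheta h12 (homClass hH f) =
      homClass (h12.trans hH) (f.comp (inclCMH h12)) :=
  rfl

/-- **Junction**: `Prop15iiQuot` implies the frozen clause `Prop15ii.logUdd_mem_Fdd1` — «log(Ü) ∈ F̈¹»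
(`λ` kills `Δ_Θ`). [cite: MochizukiEtTh2009, Prop 1.5 (ii) p.23] -/
theorem Prop15iiQuot.logUdd_mem_Fdd1 {E : D.KummerData} {hC : D.Compat} (h : Prop15iiQuot E hC) :
    E.logUdd ∈ Fdd1 hC := by
  obtain ⟨lam, hstd, hspec⟩ := h
  have h23 : (D.DtpYddN 1).map D.toTheta ≤ D.GtpYdd.map D.toTheta := Subgroup.map_mono inf_le_left
  have h12 : D.DeltaTheta ≤ (D.DtpYddN 1).map D.toTheta := hC.deltaTheta_le_DtpYddTheta
  have key := ContH1.res_res (φ := MonoidHom.id D.GtpTheta) (A := D.DeltaTheta) h12 h23 E.logUdd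
  have hres : ContH1.res (MonoidHom.id D.GtpTheta) D.DeltaTheta h23 E.logUdd =
      homClass dtpYddTheta_le_deltaTheta_map lam := hspec.res_logUdd
  have h1 : homClass (h12.trans dtpYddTheta_le_deltaTheta_map) (lam.comp (inclCMH h12)) = 1 :=
    (homClass_eq_one_iff _ _).mpr fun t => (hstd.ker_iff _).mpr t.2
  rw [hres, res_homClass, h1] at key
  exact key.symm

/-- **Junction**: `Prop15iQuot` implies the frozen clause `Prop15i.logU_mem_F1` — «log(U) ∈ F¹».
[cite: MochizukiEtTh2009, Prop 1.5 (i) p.23] -/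
theorem Prop15iQuot.logU_mem_F1 {E : D.KummerData} {hC : D.Compat} (h : Prop15iQuot E hC) :
    E.logU ∈ F1 hC := by
  obtain ⟨lam, hstd, hspec⟩ := h
  have h23 : D.DtpYTheta ≤ D.GtpY.map D.toTheta := Subgroup.map_mono inf_le_left
  have h12 : D.DeltaTheta ≤ D.DtpYTheta := hC.deltaTheta_le_DtpYTheta
  have key := ContH1.res_res (φ := MonoidHom.id D.GtpTheta) (A := D.DeltaTheta) h12 h23 E.logU
  have hres : ContH1.res (MonoidHom.id D.GtpTheta) D.DeltaTheta h23 E.logU =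
      homClass dtpYTheta_le_deltaTheta_map lam := hspec.res_logU
  have h1 : homClass (h12.trans dtpYTheta_le_deltaTheta_map) (lam.comp (inclCMH h12)) = 1 :=
    (homClass_eq_one_iff _ _).mpr fun t => (hstd.ker_iff _).mpr t.2
  rw [hres, res_homClass, h1] at key
  exact key.symm

end ThetaSetting

end Literature.AnabelianGeometry.EtaleTheta

end
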